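import Literature.NumberTheory.Automorphic.AlgebraicWeightStageLattices
import Literature.NumberTheory.Automorphic.TwistedQuotientIntFunHeckePolyReduction
import HarnessLib

/-!
# The lattice model of `H^q(X_U, Ẽ_λ)`: realization maps `H^q(Γ, indFun M) → H^q(X_U, Ẽ_λ)`

Topic `NumberTheory/Automorphic`; namespace `Literature.NumberTheory.Automorphic.AlgebraicWeight`.
Definitions with bodies and theorems; no named fact, no instance, no `sorry`.

For a level `U ⊆ GL_n(𝔸_K^∞)`, `Γ = GL_n(K)`, `ι` the global embedding, `π = padicCoeffRep`
(`V = V_λ(ℚ̄_p)`), `π_ℤ = padicIntRep`, and a `π_ℤ(U)`-stable `ℤ_p`-submodule `M ⊆ V`: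

* `realizeTop q : H^q(Γ, indFun ι U (latticeRep ⊤)) →ₛₗ[ℤ_p → ℚ̄_p] H^q(X_U, Ẽ_λ)` — the composite
  of `H^q(intFunIso⁻¹ ≫ intFunTopIso)` with the comparison `cohomologyResScalars` of the
  cohomology over `ℤ_p` and over `ℚ̄_p`; it is **bijective** (`realizeTop_bijective`);
* `realize M hM q = realizeTop ∘ H^q(indFunMap (M ↪ ⊤))`, natural in `M` (`realize_map_indFunMap`)
  and **Hecke-equivariant**: `realize (H^q(heckeIndHom t) x) = T_t (realize x)`
  (`realize_heckeIndHom`), with the polynomial version `realize_heckePolyInd`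
  (`realize (Q(T_ind) x) = Q(T) (realize x)`, `heckePolyEnd Q = Q(T)` on `H^q(X_U, Ẽ_λ)`) and its
  powers.

This is the dictionary between the integral models `H^q(X_U, M̃)` and the rational cohomology with
its Hecke action in the proof of [Scholze2015, Thm. V.4.1].

## References

* P. Scholze, *On torsion in the cohomology of locally symmetric varieties*, Ann. of Math. 182
  (2015), §V.4, proof of Thm. V.4.1. [Scholze2015]
-/

noncomputable section

open CategoryTheory
open IsDedekindDomain NumberField
open Literature.NumberTheory.Automorphic.BigHeckeGLn Literature.NumberTheory.Automorphic.TwistedQuotient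

namespace Literature.NumberTheory.Automorphic

namespace AlgebraicWeight

variable (K : Type) [Field K] [NumberField K] (n p : ℕ) [Fact p.Prime]
  (lam : (K →+* PadicAlgCl p) → Fin n → ℤ) (U : Subgroup (FiniteAdelicGL n K))

/-- `π_ℤ ∘ ι = (π ∘ ι)|ℤ_p`, definitionally. [folklore] -/
theorem padicIntRep_comp_globalEmbedding :
    (padicIntRep K n p lam).comp (globalEmbedding n K) =
      resScalars ℤ_[p] ((ResGLnCohomology.padicCoeffRep n K p lam).comp (globalEmbedding n K)) :=
  rfl

/-- `⊤ ⊆ V` is `π_ℤ(U)`-stable. [folklore] -/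
theorem top_stable' : ∀ u ∈ U, ∀ m ∈ (⊤ : Submodule ℤ_[p]
    (ResGLnCohomology.CoeffModule (PadicAlgCl p) n K lam)), padicIntRep K n p lam u m ∈
      (⊤ : Submodule ℤ_[p] (ResGLnCohomology.CoeffModule (PadicAlgCl p) n K lam)) :=
  top_stable U (padicIntRep K n p lam)

/-! ### The realization maps -/

/-- **`H^q(Γ, indFun ι U (latticeRep ⊤)) ≅ H^q_{ℤ_p}(X_U, Ẽ_λ)`**: the isomorphism of `ℤ_p`-modules
induced by `intFunIso⁻¹ ≫ intFunTopIso`. [folklore] -/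
def indTopIso (q : ℕ) :
    groupCohomology (indFun (globalEmbedding n K) U
        (latticeRep U (padicIntRep K n p lam) ⊤ (top_stable' K n p lam U))) q ≅
      TwistedQuotient.cohomology (globalEmbedding n K) U
        (resScalars ℤ_[p] ((ResGLnCohomology.padicCoeffRep n K p lam).comp (globalEmbedding n K)))
        q :=
  (groupCohomology.functor ℤ_[p] (GL (Fin n) K) q).mapIso
    ((intFunIso (globalEmbedding n K) U (padicIntRep K n p lam) ⊤ (top_stable' K n p lam U)).symm ≪≫
      intFunTopIso (globalEmbedding n K) U (padicIntRep K n p lam))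

/-- **The realization map on the full lattice `⊤`**:
`H^q(Γ, indFun (latticeRep ⊤)) → H^q(X_U, Ẽ_λ)` (semilinear along `ℤ_p → ℚ̄_p`). [folklore] -/
def realizeTop (q : ℕ) :
    groupCohomology (indFun (globalEmbedding n K) U
        (latticeRep U (padicIntRep K n p lam) ⊤ (top_stable' K n p lam U))) q →ₛₗ[algebraMap ℤ_[p]
      (PadicAlgCl p)] TwistedQuotient.cohomology (globalEmbedding n K) U
        ((ResGLnCohomology.padicCoeffRep n K p lam).comp (globalEmbedding n K)) q :=
  (cohomologyResScalars ℤ_[p] (globalEmbedding n K) U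
      ((ResGLnCohomology.padicCoeffRep n K p lam).comp (globalEmbedding n K)) q).comp
    (indTopIso K n p lam U q).hom.hom

/-- Unfolding lemma. [folklore] -/
theorem realizeTop_apply (q : ℕ) (x) :
    realizeTop K n p lam U q x =
      cohomologyResScalars ℤ_[p] (globalEmbedding n K) U
        ((ResGLnCohomology.padicCoeffRep n K p lam).comp (globalEmbedding n K)) q
        ((indTopIso K n p lam U q).hom.hom x) :=
  rfl

/-- **`realizeTop` is bijective.** [folklore] -/
theorem realizeTop_bijective (q : ℕ) : Function.Bijective (realizeTop K n p lam U q) :=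
  (cohomologyResScalars_bijective ℤ_[p] (globalEmbedding n K) U _ q).comp
    (indTopIso K n p lam U q).toLinearEquiv.bijective

variable (M : Submodule ℤ_[p] (ResGLnCohomology.CoeffModule (PadicAlgCl p) n K lam))
  (hM : ∀ u ∈ U, ∀ m ∈ M, padicIntRep K n p lam u m ∈ M)

/-- The inclusion `M ↪ ⊤` on induced modules. [folklore] -/
def indInclTop :
    indFun (globalEmbedding n K) U (latticeRep U (padicIntRep K n p lam) M hM) ⟶
      indFun (globalEmbedding n K) U (latticeRep U (padicIntRep K n p lam) ⊤ (top_stable' K n p lam U)) :=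
  indFunMap (globalEmbedding n K) U _ _
    (latticeIncl U (padicIntRep K n p lam) (le_top : M ≤ ⊤) hM (top_stable' K n p lam U))

/-- **The realization map `H^q(Γ, indFun (latticeRep M)) → H^q(X_U, Ẽ_λ)`** for a stable lattice
`M`: `realizeTop ∘ H^q(indFunMap (M ↪ ⊤))`. [cite: Scholze2015, §V.4 (H^i(X_K, 𝓜_{ξ,K}) → H^i ⊗ ℚ̄_p)] -/
def realize (q : ℕ) :
    groupCohomology (indFun (globalEmbedding n K) U (latticeRep U (padicIntRep K n p lam) M hM)) q
      →ₛₗ[algebraMap ℤ_[p] (PadicAlgCl p)] TwistedQuotient.cohomology (globalEmbedding n K) U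
        ((ResGLnCohomology.padicCoeffRep n K p lam).comp (globalEmbedding n K)) q :=
  (realizeTop K n p lam U q).comp
    ((groupCohomology.functor ℤ_[p] (GL (Fin n) K) q).map (indInclTop K n p lam U M hM)).hom

/-- Unfolding lemma. [folklore] -/
theorem realize_apply (q : ℕ) (x) :
    realize K n p lam U M hM q x = realizeTop K n p lam U q
      (((groupCohomology.functor ℤ_[p] (GL (Fin n) K) q).map (indInclTop K n p lam U M hM)).hom x) :=
  rfl

/-- Composition of inclusions of lattices on induced modules. [folklore] -/
theorem indFunMap_latticeIncl_comp {M' : Submodule ℤ_[p] (ResGLnCohomology.CoeffModule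
    (PadicAlgCl p) n K lam)} (hM' : ∀ u ∈ U, ∀ m ∈ M', padicIntRep K n p lam u m ∈ M')
    (hMM' : M ≤ M') :
    indFunMap (globalEmbedding n K) U _ _ (latticeIncl U (padicIntRep K n p lam) hMM' hM hM') ≫
        indInclTop K n p lam U M' hM' = indInclTop K n p lam U M hM :=
  Rep.hom_ext (Representation.IntertwiningMap.ext (LinearMap.ext fun _ =>
    Subtype.ext (funext fun _ => rfl)))

/-- **Naturality of `realize` in the lattice**: `realize_{M'} ∘ H^q(indFunMap (M ↪ M')) = realize_M`.
[folklore] -/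
theorem realize_map_indFunMap {M' : Submodule ℤ_[p] (ResGLnCohomology.CoeffModule
    (PadicAlgCl p) n K lam)} (hM' : ∀ u ∈ U, ∀ m ∈ M', padicIntRep K n p lam u m ∈ M')
    (hMM' : M ≤ M') (q : ℕ) (x) :
    realize K n p lam U M' hM' q (((groupCohomology.functor ℤ_[p] (GL (Fin n) K) q).map
      (indFunMap (globalEmbedding n K) U _ _
        (latticeIncl U (padicIntRep K n p lam) hMM' hM hM'))).hom x) =
      realize K n p lam U M hM q x := by
  rw [realize_apply, realize_apply, ← ModuleCat.comp_apply, ← Functor.map_comp,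
    indFunMap_latticeIncl_comp]

/-- `realize ⊤ = realizeTop`. [folklore] -/
theorem realize_top (q : ℕ) (x) :
    realize K n p lam U ⊤ (top_stable' K n p lam U) q x = realizeTop K n p lam U q x := by
  rw [realize_apply]
  have h : indInclTop K n p lam U ⊤ (top_stable' K n p lam U) = 𝟙 _ :=
    Rep.hom_ext (Representation.IntertwiningMap.ext (LinearMap.ext fun _ =>
      Subtype.ext (funext fun _ => rfl)))
  rw [h, CategoryTheory.Functor.map_id]
  rfl

/-! ### Hecke equivariance -/

/-- `indInclTop = intFunIso⁻¹ ≫ intFunIncl ≫ intFunIso_⊤`. [folklore] -/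
theorem indInclTop_eq :
    indInclTop K n p lam U M hM =
      (intFunIso (globalEmbedding n K) U (padicIntRep K n p lam) M hM).inv ≫
        intFunIncl (globalEmbedding n K) U (padicIntRep K n p lam) (le_top : M ≤ ⊤) ≫
          (intFunIso (globalEmbedding n K) U (padicIntRep K n p lam) ⊤ (top_stable' K n p lam U)).hom := by
  rw [← intFunIso_hom_comp_indFunMap (globalEmbedding n K) U (padicIntRep K n p lam) le_top hM
    (top_stable' K n p lam U), Iso.inv_hom_id_assoc]
  rfl

/-- The Hecke operator on `indFun (latticeRep M)` and on `indFun (latticeRep ⊤)` agree along the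
inclusion. [folklore] -/
theorem heckeIndHom_comp_indInclTop {t : FiniteAdelicGL n K}
    (htM : ∀ m ∈ M, padicIntRep K n p lam t m ∈ M) :
    heckeIndHom (globalEmbedding n K) (padicIntRep K n p lam) M hM htM ≫ indInclTop K n p lam U M hM =
      indInclTop K n p lam U M hM ≫ heckeIndHom (globalEmbedding n K) (padicIntRep K n p lam) ⊤
        (top_stable' K n p lam U) (t := t) (fun _ _ => Submodule.mem_top) := by
  rw [indInclTop_eq, heckeIndHom, heckeIndHom]
  simp only [Category.assoc, Iso.hom_inv_id_assoc]
  rw [heckeIntHom_comp_intFunIncl_assoc (globalEmbedding n K) U (padicIntRep K n p lam) le_top hM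
    (top_stable' K n p lam U) htM (fun _ _ => Submodule.mem_top)]

/-- The Hecke operator on `indFun (latticeRep ⊤)` and `T_t` on `Fun(𝒢/U, V)` agree along
`intFunIso⁻¹ ≫ intFunTopIso`. [folklore] -/
theorem heckeIndHom_comp_isos (t : FiniteAdelicGL n K) :
    heckeIndHom (globalEmbedding n K) (padicIntRep K n p lam) ⊤ (top_stable' K n p lam U)
        (t := t) (fun _ _ => Submodule.mem_top) ≫
      ((intFunIso (globalEmbedding n K) U (padicIntRep K n p lam) ⊤ (top_stable' K n p lam U)).symm ≪≫
        intFunTopIso (globalEmbedding n K) U (padicIntRep K n p lam)).hom =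
      ((intFunIso (globalEmbedding n K) U (padicIntRep K n p lam) ⊤ (top_stable' K n p lam U)).symm ≪≫
        intFunTopIso (globalEmbedding n K) U (padicIntRep K n p lam)).hom ≫
        heckeRepHom (globalEmbedding n K) U ((padicIntRep K n p lam).comp (globalEmbedding n K)) t := by
  rw [Iso.trans_hom, Iso.symm_hom, heckeIndHom, Category.assoc, Category.assoc,
    Iso.hom_inv_id_assoc, Category.assoc, intFunTopIso_hom_comp_heckeRepHom]

/-- **`realizeTop` is Hecke-equivariant.** [folklore] -/
theorem realizeTop_heckeIndHom (t : FiniteAdelicGL n K) (q : ℕ) (x) :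
    realizeTop K n p lam U q (((groupCohomology.functor ℤ_[p] (GL (Fin n) K) q).map
      (heckeIndHom (globalEmbedding n K) (padicIntRep K n p lam) ⊤ (top_stable' K n p lam U)
        (t := t) (fun _ _ => Submodule.mem_top))).hom x) =
      TwistedQuotient.heckeEnd (globalEmbedding n K) U
        ((ResGLnCohomology.padicCoeffRep n K p lam).comp (globalEmbedding n K)) t q
        (realizeTop K n p lam U q x) := by
  rw [realizeTop_apply, realizeTop_apply, ← cohomologyResScalars_heckeEnd]
  congr 1
  change ((groupCohomology.functor ℤ_[p] (GL (Fin n) K) q).map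
      (heckeIndHom (globalEmbedding n K) (padicIntRep K n p lam) ⊤ (top_stable' K n p lam U)
        (t := t) (fun _ _ => Submodule.mem_top)) ≫
    (groupCohomology.functor ℤ_[p] (GL (Fin n) K) q).map
      ((intFunIso (globalEmbedding n K) U (padicIntRep K n p lam) ⊤ (top_stable' K n p lam U)).symm ≪≫
        intFunTopIso (globalEmbedding n K) U (padicIntRep K n p lam)).hom).hom x =
    ((groupCohomology.functor ℤ_[p] (GL (Fin n) K) q).map
      ((intFunIso (globalEmbedding n K) U (padicIntRep K n p lam) ⊤ (top_stable' K n p lam U)).symm ≪≫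
        intFunTopIso (globalEmbedding n K) U (padicIntRep K n p lam)).hom ≫
      (groupCohomology.functor ℤ_[p] (GL (Fin n) K) q).map (heckeRepHom (globalEmbedding n K) U
        ((padicIntRep K n p lam).comp (globalEmbedding n K)) t)).hom x
  rw [← Functor.map_comp, ← Functor.map_comp, heckeIndHom_comp_isos]

/-- **`realize` is Hecke-equivariant**: `realize (H^q(heckeIndHom t) x) = T_t (realize x)`.
[cite: Scholze2015, §V.4 (𝕋_{K,cl} acts on H^i(X_K, 𝓜_{ξ,K}))] -/
theorem realize_heckeIndHom {t : FiniteAdelicGL n K} (htM : ∀ m ∈ M, padicIntRep K n p lam t m ∈ M)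
    (q : ℕ) (x) :
    realize K n p lam U M hM q (((groupCohomology.functor ℤ_[p] (GL (Fin n) K) q).map
      (heckeIndHom (globalEmbedding n K) (padicIntRep K n p lam) M hM htM)).hom x) =
      TwistedQuotient.heckeEnd (globalEmbedding n K) U
        ((ResGLnCohomology.padicCoeffRep n K p lam).comp (globalEmbedding n K)) t q
        (realize K n p lam U M hM q x) := by
  rw [realize_apply, realize_apply, ← realizeTop_heckeIndHom, ← ModuleCat.comp_apply,
    ← ModuleCat.comp_apply, ← Functor.map_comp, ← Functor.map_comp, heckeIndHom_comp_indInclTop]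

/-! ### Polynomials in the Hecke operators -/

section EndForms

variable {X : Rep ℤ_[p] (GL (Fin n) K)} (q : ℕ)

omit [NumberField K] in
/-- `Hⁿ` of a sum of endomorphisms, pointwise (`End`-form of `map_id_add`). [folklore] -/
theorem map_end_add_hom_apply (φ ψ : End X) (x : groupCohomology X q) :
    (groupCohomology.map (A := X) (B := X) (MonoidHom.id _) (φ + ψ) q).hom x =
      (groupCohomology.map (A := X) (B := X) (MonoidHom.id _) φ q).hom x +
        (groupCohomology.map (A := X) (B := X) (MonoidHom.id _) ψ q).hom x := by
  have h : groupCohomology.map (A := X) (B := X) (MonoidHom.id _) (φ + ψ) q =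
      groupCohomology.map (A := X) (B := X) (MonoidHom.id _) φ q +
        groupCohomology.map (A := X) (B := X) (MonoidHom.id _) ψ q :=
    Literature.Algebra.Homology.map_id_add φ ψ q
  rw [h, ModuleCat.hom_add, LinearMap.add_apply]

omit [NumberField K] in
/-- `Hⁿ` of a product of endomorphisms, pointwise. [folklore] -/
theorem map_end_mul_hom_apply (φ ψ : End X) (x : groupCohomology X q) :
    (groupCohomology.map (A := X) (B := X) (MonoidHom.id _) (φ * ψ) q).hom x =
      (groupCohomology.map (A := X) (B := X) (MonoidHom.id _) φ q).hom
        ((groupCohomology.map (A := X) (B := X) (MonoidHom.id _) ψ q).hom x) := by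
  have h : groupCohomology.map (A := X) (B := X) (MonoidHom.id _) (φ * ψ) q =
      groupCohomology.map (A := X) (B := X) (MonoidHom.id _) ψ q ≫
        groupCohomology.map (A := X) (B := X) (MonoidHom.id _) φ q :=
    (groupCohomology.functor ℤ_[p] (GL (Fin n) K) q).map_comp ψ φ
  rw [h, ModuleCat.comp_apply]

omit [NumberField K] in
/-- `Hⁿ(-1) = -id`, pointwise. [folklore] -/
theorem map_end_neg_one_hom_apply (x : groupCohomology X q) :
    (groupCohomology.map (A := X) (B := X) (MonoidHom.id _) (-1 : End X) q).hom x = -x := by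
  have h : groupCohomology.map (A := X) (B := X) (MonoidHom.id _) (-1 : End X) q = -(𝟙 _) := by
    have h1 : groupCohomology.map (A := X) (B := X) (MonoidHom.id _) (-(𝟙 X)) q =
        -groupCohomology.map (A := X) (B := X) (MonoidHom.id _) (𝟙 X) q :=
      Literature.Algebra.Homology.map_id_neg (𝟙 X) q
    rw [groupCohomology.map_id] at h1
    exact h1
  rw [h]
  rfl

end EndForms

variable {I : Type*} (t : I → FiniteAdelicGL n K)

/-- **`Q(T)` on `H^q(X_U, Ẽ_λ)`**: evaluation of a noncommutative polynomial at the Hecke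
operators `T_{tᵢ}`. [folklore] -/
def heckePolyEnd (q : ℕ) :
    FreeRing I →+* Module.End (PadicAlgCl p) (TwistedQuotient.cohomology (globalEmbedding n K) U
      ((ResGLnCohomology.padicCoeffRep n K p lam).comp (globalEmbedding n K)) q) :=
  FreeRing.lift fun i => (groupCohomology.map (MonoidHom.id _) (heckeRepHom (globalEmbedding n K) U
    ((ResGLnCohomology.padicCoeffRep n K p lam).comp (globalEmbedding n K)) (t i)) q).hom

/-- `heckePolyEnd` on a generator is `T_{tᵢ}`. [folklore] -/
theorem heckePolyEnd_of_apply (q : ℕ) (i : I) (y) :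
    heckePolyEnd K n p lam U t q (FreeRing.of i) y =
      TwistedQuotient.heckeEnd (globalEmbedding n K) U
        ((ResGLnCohomology.padicCoeffRep n K p lam).comp (globalEmbedding n K)) (t i) q y := by
  rw [heckePolyEnd, FreeRing.lift_of]

/-- `π_ℤ(tᵢ) = 1` when `π(tᵢ) = 1`. [folklore] -/
theorem padicIntRep_eq_one (ht : ∀ i, ResGLnCohomology.padicCoeffRep n K p lam (t i) = 1) (i : I) :
    padicIntRep K n p lam (t i) = 1 :=
  LinearMap.ext fun v => by
    rw [padicIntRep_apply, ht i]
    rfl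

variable (ht : ∀ i, ResGLnCohomology.padicCoeffRep n K p lam (t i) = 1)

/-- **`Q(T_ind)` on `H^q(Γ, indFun (latticeRep M))`**: evaluation of a noncommutative polynomial at
the cohomology endomorphisms `H^q(heckeIndHom tᵢ)`. [folklore] -/
def heckePolyIndEnd (q : ℕ) :
    FreeRing I →+* Module.End ℤ_[p]
      (groupCohomology (indFun (globalEmbedding n K) U (latticeRep U (padicIntRep K n p lam) M hM)) q) :=
  FreeRing.lift fun i => (groupCohomology.map (MonoidHom.id _)
    (heckeIndHom (globalEmbedding n K) (padicIntRep K n p lam) M hM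
      (rep_mem_of_eq_one (padicIntRep K n p lam) M (padicIntRep_eq_one K n p lam t ht i))) q).hom

/-- **`H^q` of the polynomial `Q(T_ind) ∈ End (indFun M)` is `Q` evaluated at the `H^q(T_ind)`**
(pointwise). [folklore] -/
theorem map_heckePolyInd_hom_apply (q : ℕ) (Q : FreeRing I) (x) :
    (groupCohomology.map
        (A := indFun (globalEmbedding n K) U (latticeRep U (padicIntRep K n p lam) M hM))
        (B := indFun (globalEmbedding n K) U (latticeRep U (padicIntRep K n p lam) M hM))
        (MonoidHom.id _)
        (heckePolyInd (globalEmbedding n K) (padicIntRep K n p lam) M hM t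
          (padicIntRep_eq_one K n p lam t ht) Q) q).hom x =
      heckePolyIndEnd K n p lam U M hM t ht q Q x := by
  induction Q using FreeRing.induction_on generalizing x with
  | hn1 =>
    rw [map_neg, map_one, map_neg, map_one, map_end_neg_one_hom_apply]
    rfl
  | hb i =>
    rw [heckePolyInd_of, heckePolyIndEnd, FreeRing.lift_of]
  | ha Q₁ Q₂ h₁ h₂ =>
    rw [map_add, map_add, map_end_add_hom_apply, LinearMap.add_apply, h₁, h₂]
  | hm Q₁ Q₂ h₁ h₂ =>
    rw [map_mul, map_mul, map_end_mul_hom_apply, Module.End.mul_apply, h₂, h₁]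

/-- The same in the functor form used by `exists_eq_nsmul_of_pow_map_φZ_eq_zero`, with powers.
[folklore] -/
theorem functor_map_heckePolyInd_pow_apply (q : ℕ) (Q : FreeRing I) (m : ℕ) (x) :
    ((((groupCohomology.functor ℤ_[p] (GL (Fin n) K) q).map
      (show indFun (globalEmbedding n K) U (latticeRep U (padicIntRep K n p lam) M hM) ⟶
          indFun (globalEmbedding n K) U (latticeRep U (padicIntRep K n p lam) M hM) from
        heckePolyInd (globalEmbedding n K) (padicIntRep K n p lam) M hM t
          (padicIntRep_eq_one K n p lam t ht) Q)).hom ^ m) x) =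
      (heckePolyIndEnd K n p lam U M hM t ht q Q ^ m) x := by
  induction m generalizing x with
  | zero => rfl
  | succ m ih =>
    rw [pow_succ, pow_succ, Module.End.mul_apply, Module.End.mul_apply,
      ← map_heckePolyInd_hom_apply K n p lam U M hM t ht q Q x, ih]
    rfl

/-- **`realize` intertwines `Q(T_ind)` and `Q(T)`**: `realize (Q(T_ind) x) = Q(T) (realize x)`.
[cite: Scholze2015, §V.4 (proof of Thm. V.4.1)] -/
theorem realize_heckePolyIndEnd (q : ℕ) (Q : FreeRing I) (x) :
    realize K n p lam U M hM q (heckePolyIndEnd K n p lam U M hM t ht q Q x) =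
      heckePolyEnd K n p lam U t q Q (realize K n p lam U M hM q x) := by
  induction Q using FreeRing.induction_on generalizing x with
  | hn1 =>
    rw [map_neg, map_one, map_neg, map_one]
    exact map_neg (realize K n p lam U M hM q) x
  | hb i =>
    rw [heckePolyIndEnd, FreeRing.lift_of, heckePolyEnd_of_apply]
    exact realize_heckeIndHom K n p lam U M hM _ q x
  | ha Q₁ Q₂ h₁ h₂ =>
    rw [map_add, map_add, LinearMap.add_apply, LinearMap.add_apply, map_add, h₁, h₂]
  | hm Q₁ Q₂ h₁ h₂ =>
    rw [map_mul, map_mul, Module.End.mul_apply, Module.End.mul_apply, h₁, h₂]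

/-- Powers: `realize ((Q(T_ind))^m x) = (Q(T))^m (realize x)`. [folklore] -/
theorem realize_heckePolyIndEnd_pow (q : ℕ) (Q : FreeRing I) (m : ℕ) (x) :
    realize K n p lam U M hM q ((heckePolyIndEnd K n p lam U M hM t ht q Q ^ m) x) =
      (heckePolyEnd K n p lam U t q Q ^ m) (realize K n p lam U M hM q x) := by
  induction m generalizing x with
  | zero => rfl
  | succ m ih =>
    rw [pow_succ, pow_succ, Module.End.mul_apply, Module.End.mul_apply, ih,
      realize_heckePolyIndEnd]

end AlgebraicWeight

end Literature.NumberTheory.Automorphic
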